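import Literature.Computability.Learning.OccamFinite
import HarnessLib

/-!
# Occam's razor, cardinality version (proofs)

Sibling proof file of `Literature/Computability/Learning/OccamFinite.lean` (D-0014: the named facts
stay `def`s upstream; this file discharges them). It proves

* `occam_uniform_bound_holds : occam_uniform_bound` — for a distribution `D` on `X`, a target
  `c : X → Y`, a finite hypothesis set `H`, `0 < ε ≤ 1` and `m` i.i.d. samples `S ∼ D^m`
  (`iidList D m`): `Pr_S[∃ h ∈ H, h consistent with c on S ∧ R(h) > ε] ≤ |H| (1 - ε)^m`;
* `occam_finite_consistent_holds : occam_finite_consistent` — the sample-complexity form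
  (Mohri–Rostamizadeh–Talwalkar Thm. 2.5: `m ≥ (1/ε)(ln |H| + ln (1/δ))` samples suffice), by the
  upstream reduction `occam_finite_consistent_of_uniform`.

**The printed proof** (Mohri–Rostamizadeh–Talwalkar 2018, proof of Thm. 2.5; equally
Kearns–Vazirani 1994, Thm. 2.1 and Blumer–Ehrenfeucht–Haussler–Warmuth 1987): fix `h ∈ H` with
`R(h) > ε`; the `m` sample points are drawn independently, so the probability that `h` is
consistent with all of them is `(1 − R(h))^m ≤ (1 − ε)^m`; the union bound over the (at most `|H|`)
such `h` gives `|H| (1 − ε)^m`. Here: `toOuterMeasure_iidList_consistent` is the product formula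
`Pr_{S ∼ D^m}[h consistent on S] = (D{h = c})^m` (induction on `m` along
`iidList D (m+1) = D.bind (a ↦ (a :: ·) <$> iidList D m)`, `PMF.toOuterMeasure_bind_apply`),
`toOuterMeasure_eq_add_ne` is `D{h = c} + D{h ≠ c} = 1`, and the union bound is
`MeasureTheory.measure_biUnion_finset_le` for the outer measure of `iidList D m`.

Besides the PneNP/Learning route (`wi-03893`), the bound is the "standard result of PAC learning"
invoked in Aaronson–Chen 2017, proof of Lemma 8.2 (tree fact
`Literature.Barriers.QuantumAdvantage.aaronsonChen2017_lem82`): a `poly(n, ε₁⁻¹, ln δ₁⁻¹)` number of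
i.i.d. samples from `Q` and any `g ∈ SIZE(q(n))` consistent with them give
`Pr_{i∼Q}[f(i) ≠ g(i)] ≤ ε₁` with probability `≥ 1 − δ₁` (finite class: the size-`q(n)` circuits on
`n` inputs).

## References

* M. Mohri, A. Rostamizadeh, A. Talwalkar, *Foundations of Machine Learning*, 2nd ed., MIT Press
  2018, §2.2, Thm. 2.5 and its proof [MohriRostamizadehTalwalkar2018].
* A. Blumer, A. Ehrenfeucht, D. Haussler, M. K. Warmuth, *Occam's razor*, Inform. Process.
  Lett. 24 (1987) 377–380 [BlumerEhrenfeuchtHausslerWarmuth1987].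
* M. J. Kearns, U. V. Vazirani, *An Introduction to Computational Learning Theory* (1994),
  Thm. 2.1 [KearnsVazirani1994].
* S. Aaronson, L. Chen, CCC 2017 (arXiv:1612.05903), proof of Lemma 8.2 (p. 33) [AaronsonChen2017].
-/

noncomputable section

namespace Literature.Computability.Learning

open _root_.MeasureTheory

variable {X Y : Type}

/-! ### One hypothesis: the product formula -/

/-- `iidList D (m+1)` draws a head from `D` and an independent tail from `iidList D m`
(definitional unfolding). [folklore] -/
theorem iidList_succ (D : PMF X) (m : ℕ) :
    iidList D (m + 1) = D.bind fun a => (iidList D m).map (a :: ·) := rfl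

/-- Consistency with the target on `a :: S` is consistency at `a` and on `S`. [folklore] -/
theorem isConsistentOn_cons (h c : X → Y) (a : X) (S : List X) :
    IsConsistentOn h c (a :: S) ↔ h a = c a ∧ IsConsistentOn h c S :=
  List.forall_mem_cons

/-- The empty sample is consistent with everything. [folklore] -/
theorem isConsistentOn_nil (h c : X → Y) : IsConsistentOn h c [] := fun x hx => by simp at hx

/-- `D{h = c} + D{h ≠ c} = 1`: the agreement and disagreement regions partition `X`.
[Mohri–Rostamizadeh–Talwalkar 2018, proof of Thm. 2.5 (`1 − R(h)`)] [folklore] -/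
theorem toOuterMeasure_eq_add_ne (D : PMF X) (h c : X → Y) :
    D.toOuterMeasure {x | h x = c x} + D.toOuterMeasure {x | h x ≠ c x} = 1 := by
  classical
  rw [PMF.toOuterMeasure_apply, PMF.toOuterMeasure_apply, ← ENNReal.tsum_add, ← D.tsum_coe]
  refine tsum_congr fun x => ?_
  by_cases hx : h x = c x
  · rw [Set.indicator_of_mem (by exact hx), Set.indicator_of_notMem (by simpa using hx), add_zero]
  · rw [Set.indicator_of_notMem (by exact hx), Set.indicator_of_mem (by simpa using hx), zero_add]

/-- The disagreement probability (generalisation error) is at most `1`. [folklore] -/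
theorem genError_le_one (D : PMF X) (h c : X → Y) : genError D h c ≤ 1 := by
  rw [genError, ← toOuterMeasure_eq_add_ne D h c]
  exact le_add_self

/-- The agreement probability is `1 − R(h)`. [Mohri–Rostamizadeh–Talwalkar 2018, proof of Thm. 2.5]
[folklore] -/
theorem toOuterMeasure_eq_eq_one_sub_genError (D : PMF X) (h c : X → Y) :
    D.toOuterMeasure {x | h x = c x} = 1 - genError D h c :=
  ENNReal.eq_sub_of_add_eq ((genError_le_one D h c).trans_lt ENNReal.one_lt_top).ne
    (toOuterMeasure_eq_add_ne D h c)

/-- **Independent samples: `Pr_{S ∼ D^m}[h consistent with c on S] = (D{h = c})^m`** ("the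
probability that `h` is consistent with an i.i.d. sample of size `m` is `(1 − R(h))^m`"), by
induction on `m`: the head must fall in the agreement region and the tail must be consistent.
[cite: MohriRostamizadehTalwalkar2018, Thm. 2.5 (proof)] -/
theorem toOuterMeasure_iidList_consistent (D : PMF X) (h c : X → Y) :
    ∀ m : ℕ, (iidList D m).toOuterMeasure {S | IsConsistentOn h c S} =
      D.toOuterMeasure {x | h x = c x} ^ m
  | 0 => by
    rw [iidList_zero, PMF.toOuterMeasure_pure_apply, pow_zero, Set.mem_setOf_eq,
      if_pos (isConsistentOn_nil h c)]
  | m + 1 => by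
    classical
    rw [iidList_succ, PMF.toOuterMeasure_bind_apply, pow_succ']
    conv_rhs => arg 1; rw [PMF.toOuterMeasure_apply]
    rw [← ENNReal.tsum_mul_right]
    refine tsum_congr fun a => ?_
    rw [PMF.toOuterMeasure_map_apply]
    by_cases ha : h a = c a
    · have hpre : (a :: ·) ⁻¹' {S : List X | IsConsistentOn h c S} = {S | IsConsistentOn h c S} := by
        ext S
        simp only [Set.mem_preimage, Set.mem_setOf_eq, isConsistentOn_cons, ha, true_and]
      rw [hpre, toOuterMeasure_iidList_consistent D h c m, Set.indicator_of_mem (by exact ha)]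
    · have hpre : (a :: ·) ⁻¹' {S : List X | IsConsistentOn h c S} = ∅ := by
        ext S
        simp only [Set.mem_preimage, Set.mem_setOf_eq, isConsistentOn_cons, ha, false_and,
          Set.mem_empty_iff_false]
      rw [hpre, measure_empty, mul_zero, Set.indicator_of_notMem (by exact ha), zero_mul]

/-- For a hypothesis with error `R(h) > ε` (`0 ≤ ε ≤ 1`), the probability of being consistent with
`m` i.i.d. samples is at most `(1 − ε)^m`. [cite: MohriRostamizadehTalwalkar2018, Thm. 2.5 (proof)] -/
theorem toOuterMeasure_iidList_consistent_le (D : PMF X) {h c : X → Y} {ε : ℝ} (hε : 0 ≤ ε)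
    (hbad : ENNReal.ofReal ε < genError D h c) (m : ℕ) :
    (iidList D m).toOuterMeasure {S | IsConsistentOn h c S} ≤ ENNReal.ofReal ((1 - ε) ^ m) := by
  have hε1 : ε ≤ 1 := by
    by_contra hlt
    exact (hbad.trans_le (genError_le_one D h c)).not_ge
      (ENNReal.one_le_ofReal.2 (le_of_not_ge hlt))
  rw [toOuterMeasure_iidList_consistent, toOuterMeasure_eq_eq_one_sub_genError,
    ENNReal.ofReal_pow (by linarith) m, ENNReal.ofReal_sub 1 hε, ENNReal.ofReal_one]
  exact pow_le_pow_left' (tsub_le_tsub_left hbad.le 1) m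

/-! ### The union bound over the class -/

/-- The bad event is contained in the union, over the hypotheses of `H` with error `> ε`, of their
consistency events. [cite: MohriRostamizadehTalwalkar2018, Thm. 2.5 (proof)] -/
theorem occamBadEvent_subset_biUnion (D : PMF X) (c : X → Y) (H : Finset (X → Y))
    (ε : ℝ) [DecidablePred fun h : X → Y => ENNReal.ofReal ε < genError D h c] :
    occamBadEvent D c H ε ⊆
      ⋃ h ∈ H.filter (fun h => ENNReal.ofReal ε < genError D h c), {S | IsConsistentOn h c S} := by
  rintro S ⟨h, hH, hcons, hbad⟩
  exact Set.mem_iUnion₂.2 ⟨h, Finset.mem_filter.2 ⟨hH, hbad⟩, hcons⟩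

/-- **Discharge of `occam_uniform_bound`** (Occam's razor, cardinality version, uniform form):
`Pr_{S ∼ D^m}[∃ h ∈ H consistent with c on S, R(h) > ε] ≤ |H| (1 − ε)^m` for `0 < ε ≤ 1` — the
union bound over the bad hypotheses of the one-hypothesis bound `(1 − R(h))^m ≤ (1 − ε)^m`.
[cite: MohriRostamizadehTalwalkar2018, Thm. 2.5 (proof)] -/
theorem occam_uniform_bound_holds : occam_uniform_bound := by
  intro X Y D c H ε hε _hε1 m
  classical
  set bad := H.filter fun h => ENNReal.ofReal ε < genError D h c with hbad
  calc (iidList D m).toOuterMeasure (occamBadEvent D c H ε)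
      ≤ (iidList D m).toOuterMeasure (⋃ h ∈ bad, {S | IsConsistentOn h c S}) :=
        measure_mono (occamBadEvent_subset_biUnion D c H ε)
    _ ≤ ∑ h ∈ bad, (iidList D m).toOuterMeasure {S | IsConsistentOn h c S} :=
        measure_biUnion_finset_le bad _
    _ ≤ ∑ h ∈ bad, ENNReal.ofReal ((1 - ε) ^ m) :=
        Finset.sum_le_sum fun h hh =>
          toOuterMeasure_iidList_consistent_le D hε.le (Finset.mem_filter.1 hh).2 m
    _ = (bad.card : ENNReal) * ENNReal.ofReal ((1 - ε) ^ m) := by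
        rw [Finset.sum_const, nsmul_eq_mul]
    _ ≤ (H.card : ENNReal) * ENNReal.ofReal ((1 - ε) ^ m) := by
        gcongr
        exact Finset.filter_subset _ H

/-- **Discharge of `occam_finite_consistent`** (Mohri–Rostamizadeh–Talwalkar 2018, Thm. 2.5,
sample-complexity form (2.8)): with `m ≥ (1/ε)(ln |H| + ln (1/δ))` i.i.d. samples, the probability
that some hypothesis of the finite class `H` is consistent with the target on the sample and yet
has error `> ε` is at most `δ` — from the uniform bound by the upstream reduction
`occam_finite_consistent_of_uniform`. [cite: MohriRostamizadehTalwalkar2018, Thm. 2.5] -/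
theorem occam_finite_consistent_holds : occam_finite_consistent :=
  occam_finite_consistent_of_uniform occam_uniform_bound_holds

end Literature.Computability.Learning

end
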